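import Mathlib
import Summits.MatrixMultiplication.Statement
import Summits.MatrixMultiplication.MatrixMultiplication.Theorems.GraphEquationsKernelFieldRung

/-!
# The cubic specimen: at degree four ONE round cannot reach order one (`GraphEquations`, M78a)

Decomp-mm node «GraphEquations» (lens 5); attacked leaf `MultiplicityReduction`
(stmt-MatrixMultiplication-27806); target of the node, VERBATIM: `_root_.MatrixMultiplication`.

The one-round kernel-field dial `KernelFieldClauseDeg D K` (M76): every correct degree-`≤ D` system
`E` has a KERNEL FIELD `μ` (`D_μ t ∈ I(Γ)` for every test), exposed at cost `≤ c·(cost E + n²)`, such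
that every system containing the `μ`-deflation of `E` is ideal-initially-isolated to order `K` over
some base pair; `KernelFieldClauseDeg 4 K → ω₄ = ω` for `K ≤ 2`, and the chain, rigid-quadric and
fan specimens satisfy the clause with `K = 1` (M77).  **This kernel refutes `K = 1`:
`¬ KernelFieldClauseDeg 4 1`**, by a COST-FREE specimen (every kernel field fails, whatever its
cost).  **The cubic specimen** (`cubicTest`, `n² ≥ 2`, positions `p₀, p₁, …`,
`α := (ab)_{p₁} = Σ_k a_{p₁.1 k} b_{k p₁.2}`, `c₁ := c_{p₁}`), all tests of degree `≤ 4`: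

  `t₀ = f_{p₀} + α·f_{p₁}`,  `t₁ = f_{p₁}·c₁² + α·f_{p₀} + 2·f_{p₀}·f_{p₁}`,  `t_i = f_{p_i}` (`i ≥ 2`).

On `t₀ = 0` one has `t₁ = f_{p₁}³` (`cubicTest_zero_iff`: the system is CORRECT); in fibre
coordinates the tests read `F₀ + αF₁`, `F₁³ + 2αF₁² + α(F₀ + αF₁) + 2F₀F₁`, `F_{p_i}`: the linear
parts have the common kernel `v = (α, −1, 0, …)`, every QUADRATIC part vanishes on `v`
(`2αF₁² + 2F₀F₁ = 2F₁(F₀ + αF₁)`), only the CUBIC part `F₁³` sees `v`.  Over EVERY base pair `y`: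
* `exists_cubicSystem`: correct, degree `≤ 4`, test ideal initially isolated to NO order `K ≤ 2`
  (masking line `F ↦ s·v`: `t₀ ↦ 0`, `t₁ ↦ −s³`);
* `cubic_kernelField_iff`: the kernel fields are exactly `μ = g·v`, and for each of them
  `D_μ t₁ = −g·(3F₁² + 2αF₁ + 2F₀)`, so the `μ`-deflation is STILL order-blind below `2` along the
  same line (`cubic_one_round_not_order_one`): **no kernel field reaches order `1` in one round** —
  `not_kernelFieldClauseDeg_four_one`, `not_kernelFieldClauseDeg_four_le_one`.
The positive half (`v` reaches order `2` in one round, order `1` in two; the specimen satisfies the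
clause of `KernelFieldClauseDeg 4 2`) is the companion kernel `GraphEquationsCubicSpecimenOrders`.
No `sorry`.

Sources: Leykin–Verschelde–Zhao, TCS 359 (2006) [doi:10.1016/j.tcs.2006.02.018], Thm 3.1 (each
deflation round lowers multiplicity; higher multiplicity needs more rounds);
[BurgisserClausenShokrollahi1997, §7.1, Problem 16.3].
-/

set_option linter.dupNamespace false

noncomputable section
open scoped BigOperators

namespace Summit.MatrixMultiplication.MatrixMultiplication.Theorems.GraphEquations

open MvPolynomial Matrix Literature.Computability.AlgebraicComplexity
open Literature.Computability.AlgebraicComplexity.ArithCircuit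

variable {n : ℕ}

/-! ## The base bilinear form `(ab)_q` and fibre coordinates of `c_q` -/

/-- `(ab)_q = Σ_k a_{q₁ k} b_{k q₂}` as a polynomial in the BASE variables. -/
def abBase (n : ℕ) (q : Fin n × Fin n) : MvPolynomial (MatMulVars n) ℂ :=
  ∑ k : Fin n, X (Sum.inl (q.1, k)) * X (Sum.inr (k, q.2))

/-- `ι((ab)_q) = c_q − f_q`. -/
theorem liftAB_abBase (q : Fin n × Fin n) : liftAB n (abBase n q) = X (Sum.inr q) - generator n q := by
  rw [generator, sub_sub_cancel]
  simp [abBase, map_sum]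

/-- `liftF c_q = F_q + (ab)_q`. -/
theorem liftF_X_inr_eq (q : Fin n × Fin n) :
    liftF n (X (Sum.inr q) : MvPolynomial (GraphVars n) ℂ) = X q + C (abBase n q) := by
  simp [liftF, abBase]

/-- `ι((ab)_q)` has degree `≤ 2`. -/
theorem totalDegree_liftAB_abBase_le (q : Fin n × Fin n) : (liftAB n (abBase n q)).totalDegree ≤ 2 := by
  rw [liftAB_abBase]
  exact (totalDegree_sub _ _).trans (max_le ((totalDegree_X _).le.trans (by norm_num))
    (totalDegree_generator_le_two n q))

/-- Case analysis over the positions `p₀, p₁` and the rest. -/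
theorem chainPos_cases₂ (h2 : 2 ≤ n * n) {P : Fin n × Fin n → Prop} (h0 : P (chainPos n ⟨0, by omega⟩))
    (h1 : P (chainPos n ⟨1, by omega⟩))
    (hrest : ∀ i : Fin (n * n), i.val ≠ 0 → i.val ≠ 1 → P (chainPos n i)) (q : Fin n × Fin n) : P q := by
  obtain ⟨i, rfl⟩ := exists_chainPos_eq q
  by_cases hi0 : i.val = 0
  · rw [show i = ⟨0, by omega⟩ from Fin.ext hi0]; exact h0
  by_cases hi1 : i.val = 1
  · rw [show i = ⟨1, by omega⟩ from Fin.ext hi1]; exact h1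
  exact hrest i hi0 hi1

/-! ## The cubic specimen -/

/-- `α = (ab)_{p₁}`. -/
def cubicA (h2 : 2 ≤ n * n) : MvPolynomial (MatMulVars n) ℂ := abBase n (chainPos n ⟨1, by omega⟩)

/-- The cubic tests: `t₀ = f_{p₀} + α f_{p₁}`, `t₁ = f_{p₁} c_{p₁}² + α f_{p₀} + 2 f_{p₀} f_{p₁}`,
`t_i = f_{p_i}` (`i ≥ 2`). -/
def cubicTest (h2 : 2 ≤ n * n) (i : Fin (n * n)) : MvPolynomial (GraphVars n) ℂ :=
  if i.val = 0 then generator n (chainPos n ⟨0, by omega⟩) +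
      liftAB n (cubicA h2) * generator n (chainPos n ⟨1, by omega⟩)
  else if i.val = 1 then
    generator n (chainPos n ⟨1, by omega⟩) * X (Sum.inr (chainPos n ⟨1, by omega⟩)) ^ 2 +
      liftAB n (cubicA h2) * generator n (chainPos n ⟨0, by omega⟩) +
      2 * (generator n (chainPos n ⟨0, by omega⟩) * generator n (chainPos n ⟨1, by omega⟩))
  else generator n (chainPos n i)

/-- The cubic tests in fibre coordinates: `F₀ + αF₁`, `F₁(F₁ + α)² + αF₀ + 2F₀F₁`, `F_{p_i}`. -/
def cubicG (h2 : 2 ≤ n * n) (i : Fin (n * n)) : FPoly n :=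
  if i.val = 0 then X (chainPos n ⟨0, by omega⟩) + C (cubicA h2) * X (chainPos n ⟨1, by omega⟩)
  else if i.val = 1 then
    X (chainPos n ⟨1, by omega⟩) * (X (chainPos n ⟨1, by omega⟩) + C (cubicA h2)) ^ 2 +
      C (cubicA h2) * X (chainPos n ⟨0, by omega⟩) +
      2 * (X (chainPos n ⟨0, by omega⟩) * X (chainPos n ⟨1, by omega⟩))
  else X (chainPos n i)

/-- `liftF tᵢ = Gᵢ`. -/
theorem liftF_cubicTest (h2 : 2 ≤ n * n) (i : Fin (n * n)) : liftF n (cubicTest h2 i) = cubicG h2 i := by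
  unfold cubicTest cubicG
  split_ifs <;> simp only [map_add, map_mul, map_pow, map_ofNat, liftF_generator, liftF_liftAB,
    liftF_X_inr_eq, cubicA]

/-- `substF Gᵢ = tᵢ`. -/
theorem substF_cubicG (h2 : 2 ≤ n * n) (i : Fin (n * n)) : substF n (cubicG h2 i) = cubicTest h2 i := by
  rw [← liftF_cubicTest, substF_liftF]

/-- The cubic tests have degree `≤ 4`. -/
theorem totalDegree_cubicTest_le (h2 : 2 ≤ n * n) (i : Fin (n * n)) : (cubicTest h2 i).totalDegree ≤ 4 := by
  have h0 := totalDegree_generator_le_two n (chainPos n ⟨0, by omega⟩)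
  have h1 := totalDegree_generator_le_two n (chainPos n ⟨1, by omega⟩)
  have hA : (liftAB n (cubicA h2)).totalDegree ≤ 2 := totalDegree_liftAB_abBase_le _
  have hX2 : ((X (Sum.inr (chainPos n ⟨1, by omega⟩)) : MvPolynomial (GraphVars n) ℂ) ^ 2).totalDegree ≤ 2 :=
    (totalDegree_pow _ _).trans (by rw [totalDegree_X])
  have h2c : (2 : MvPolynomial (GraphVars n) ℂ).totalDegree = 0 := by
    rw [show (2 : MvPolynomial (GraphVars n) ℂ) = C 2 from (map_ofNat C 2).symm, totalDegree_C]
  have hm01 := totalDegree_mul (generator n (chainPos n ⟨0, by omega⟩)) (generator n (chainPos n ⟨1, by omega⟩))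
  unfold cubicTest
  split_ifs
  · exact (totalDegree_add _ _).trans (max_le (h0.trans (by norm_num)) ((totalDegree_mul _ _).trans (by omega)))
  · exact (totalDegree_add _ _).trans (max_le ((totalDegree_add _ _).trans (max_le
      ((totalDegree_mul _ _).trans (by omega)) ((totalDegree_mul _ _).trans (by omega))))
      ((totalDegree_mul _ _).trans (by omega)))
  · exact (totalDegree_generator_le_two n _).trans (by norm_num)

/-- **The cubic specimen cuts out the graph**: on `t₀ = 0`, `t₁ = f_{p₁}³`. -/
theorem cubicTest_zero_iff (h2 : 2 ≤ n * n) (x : GraphVars n → ℂ) :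
    (∀ i, eval x (cubicTest h2 i) = 0) ↔ x ∈ mmGraph n := by
  rw [mem_mmGraph_iff_eval_generator]
  constructor
  · intro h
    have hα : eval x (liftAB n (cubicA h2)) =
        x (Sum.inr (chainPos n ⟨1, by omega⟩)) - eval x (generator n (chainPos n ⟨1, by omega⟩)) := by
      rw [cubicA, liftAB_abBase, map_sub, eval_X]
    have h0 : eval x (generator n (chainPos n ⟨0, by omega⟩)) +
        eval x (liftAB n (cubicA h2)) * eval x (generator n (chainPos n ⟨1, by omega⟩)) = 0 := by
      simpa only [cubicTest, if_true, map_add, map_mul] using h ⟨0, by omega⟩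
    have h1 : eval x (generator n (chainPos n ⟨1, by omega⟩)) * x (Sum.inr (chainPos n ⟨1, by omega⟩)) ^ 2 +
        eval x (liftAB n (cubicA h2)) * eval x (generator n (chainPos n ⟨0, by omega⟩)) +
        2 * (eval x (generator n (chainPos n ⟨0, by omega⟩)) * eval x (generator n (chainPos n ⟨1, by omega⟩))) = 0 := by
      simpa only [cubicTest, show (1 : ℕ) ≠ 0 from by norm_num, if_false, if_true, map_add, map_mul, map_pow,
        map_ofNat, eval_X] using h ⟨1, by omega⟩
    set g0 := eval x (generator n (chainPos n ⟨0, by omega⟩))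
    set g1 := eval x (generator n (chainPos n ⟨1, by omega⟩))
    set α := eval x (liftAB n (cubicA h2))
    set c1 := x (Sum.inr (chainPos n ⟨1, by omega⟩))
    have hcube : g1 ^ 3 = 0 := by
      linear_combination h1 - (α + 2 * g1) * h0 + g1 * (g1 + α + c1) * hα
    have hg1 : g1 = 0 := pow_eq_zero_iff (n := 3) (by norm_num) |>.1 hcube
    have hg0 : g0 = 0 := by simpa only [hg1, mul_zero, add_zero] using h0
    refine chainPos_cases₂ h2 hg0 hg1 fun i hi0 hi1 => ?_
    simpa only [cubicTest, hi0, hi1, if_false] using h i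
  · intro h i
    unfold cubicTest
    split_ifs <;> simp [map_add, map_mul, map_pow, h]

/-! ## The masked direction `v = (α, −1, 0, …)` — also the generator of the kernel fields -/

/-- The direction `v`: `v_{p₀} = α`, `v_{p₁} = −1`, `v_{p_i} = 0` (`i ≥ 2`); base-QUADRATIC. -/
def cubicDir (h2 : 2 ≤ n * n) (q : Fin n × Fin n) : MvPolynomial (MatMulVars n) ℂ :=
  if (finProdFinEquiv q).val = 0 then cubicA h2 else if (finProdFinEquiv q).val = 1 then -1 else 0

/-- Unit weights (plain `F`-order along the line `s ↦ s·v`). -/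
def cubicW (n : ℕ) : Fin n × Fin n → ℕ := fun _ => 1

/-- The direction at the positions. -/
theorem cubicDir_chainPos (h2 : 2 ≤ n * n) (i : Fin (n * n)) :
    cubicDir h2 (chainPos n i) = if i.val = 0 then cubicA h2 else if i.val = 1 then -1 else 0 := by
  simp only [cubicDir, chainPos, Equiv.apply_symm_apply]

/-- The masking substitution on the fibre variables: `F_{p_i} ↦ v_{p_i}·s`. -/
theorem maskHom_cubic_X (h2 : 2 ≤ n * n) (j : Fin (n * n)) :
    maskHom (cubicDir h2) (cubicW n) (X (chainPos n j)) =
      Polynomial.C (cubicDir h2 (chainPos n j)) * Polynomial.X ^ (cubicW n (chainPos n j)) := by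
  rw [maskHom, aeval_X]

/-- … and on base coefficients. -/
theorem maskHom_cubic_C (h2 : 2 ≤ n * n) (p : MvPolynomial (MatMulVars n) ℂ) :
    maskHom (cubicDir h2) (cubicW n) (C p) = Polynomial.C p := by
  rw [maskHom, aeval_C, Polynomial.algebraMap_eq]

/-- … and on the numeral `2`. -/
theorem maskHom_cubic_two (h2 : 2 ≤ n * n) : maskHom (cubicDir h2) (cubicW n) (2 : FPoly n) = 2 :=
  map_ofNat _ 2

/-- **Masked below order `3`**: `s³` divides the masked image of every cubic test
(`t₀ ↦ αs − αs = 0`, `t₁ ↦ −s³`, `t_i ↦ 0`). -/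
theorem X_pow_three_dvd_maskHom_cubicTest (h2 : 2 ≤ n * n) (i : Fin (n * n)) :
    Polynomial.X ^ 3 ∣ maskHom (cubicDir h2) (cubicW n) (liftF n (cubicTest h2 i)) := by
  rw [liftF_cubicTest]
  unfold cubicG
  split_ifs with h0 h1
  · refine ⟨0, ?_⟩
    rw [map_add, map_mul, maskHom_cubic_C, maskHom_cubic_X, maskHom_cubic_X, cubicDir_chainPos,
      cubicDir_chainPos]
    simp only [show (1 : ℕ) ≠ 0 from by norm_num, if_true, if_false, cubicW, pow_one, map_neg, map_one]
    ring
  · refine ⟨-1, ?_⟩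
    rw [map_add, map_add, map_mul, map_mul, map_mul, map_pow, map_add, map_mul, maskHom_cubic_C, maskHom_cubic_X,
      maskHom_cubic_X, maskHom_cubic_two, cubicDir_chainPos, cubicDir_chainPos]
    simp only [show (1 : ℕ) ≠ 0 from by norm_num, if_true, if_false, cubicW, pow_one, map_neg, map_one]
    ring
  · refine ⟨0, ?_⟩
    rw [maskHom_cubic_X, cubicDir_chainPos]
    simp only [h0, h1, if_false, map_zero, zero_mul, mul_zero]

/-- `D_γ (k·P) = k·D_γ P` for numerals `k`. -/
theorem polarDeriv_ofNat_mul {σ R : Type*} [CommRing R] [Fintype σ] (γ : σ → R) (k : ℕ) [k.AtLeastTwo]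
    (P : MvPolynomial σ R) : polarDeriv γ (ofNat(k) * P) = ofNat(k) * polarDeriv γ P := by
  rw [← map_ofNat (C : R →+* MvPolynomial σ R) k, polarDeriv_C_mul]

/-- `D_γ k = 0` for numerals `k`. -/
theorem polarDeriv_ofNat {σ R : Type*} [CommRing R] [Fintype σ] (γ : σ → R) (k : ℕ) [k.AtLeastTwo] :
    polarDeriv γ (ofNat(k) : MvPolynomial σ R) = 0 := by
  rw [← map_ofNat (C : R →+* MvPolynomial σ R) k, polarDeriv_C]

/-- The constant term of `D_μ Gᵢ` (the pairing of `μ` with the fibre-linear parts):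
`μ_{p₀} + α μ_{p₁}`, `α·(μ_{p₀} + α μ_{p₁})`, `μ_{p_i}`. -/
theorem constantCoeff_polarDeriv_cubicG (h2 : 2 ≤ n * n)
    (μ : Fin n × Fin n → MvPolynomial (MatMulVars n) ℂ) (i : Fin (n * n)) :
    constantCoeff (polarDeriv μ (cubicG h2 i)) =
      if i.val = 0 then μ (chainPos n ⟨0, by omega⟩) + cubicA h2 * μ (chainPos n ⟨1, by omega⟩)
      else if i.val = 1 then
        cubicA h2 * (μ (chainPos n ⟨0, by omega⟩) + cubicA h2 * μ (chainPos n ⟨1, by omega⟩))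
      else μ (chainPos n i) := by
  classical
  unfold cubicG
  split_ifs
  · simp only [polarDeriv_add, polarDeriv_X, polarDeriv_mul, polarDeriv_C, map_add, map_mul, constantCoeff_C,
      zero_mul, zero_add]
  · simp only [polarDeriv_add, polarDeriv_X, sq, polarDeriv_mul, polarDeriv_C, polarDeriv_ofNat, map_add,
      map_mul, map_ofNat, constantCoeff_C, constantCoeff_X, zero_mul, mul_zero, add_zero, zero_add]
    ring
  · simp only [polarDeriv_X, constantCoeff_C]

/-- **Kernel-field criterion**: `D_μ tᵢ ∈ I(Γ)` iff that constant term vanishes. -/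
theorem derivC_cubicTest_mem_iff (h2 : 2 ≤ n * n) (μ : Fin n × Fin n → MvPolynomial (MatMulVars n) ℂ)
    (i : Fin (n * n)) :
    derivC μ (cubicTest h2 i) ∈ graphIdeal n ↔ constantCoeff (polarDeriv μ (cubicG h2 i)) = 0 := by
  rw [← substF_cubicG, ← substF_polarDeriv, substF_mem_graphIdeal_iff]

/-- **THE KERNEL FIELDS OF THE CUBIC SPECIMEN are the `ℂ[a,b]`-multiples of `v`**:
`μ_{p₀} + α μ_{p₁} = 0` and `μ_{p_i} = 0` for `i ≥ 2`. -/
theorem cubic_kernelField_iff (h2 : 2 ≤ n * n) (μ : Fin n × Fin n → MvPolynomial (MatMulVars n) ℂ) :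
    (∀ i, derivC μ (cubicTest h2 i) ∈ graphIdeal n) ↔
      μ (chainPos n ⟨0, by omega⟩) + cubicA h2 * μ (chainPos n ⟨1, by omega⟩) = 0 ∧
        ∀ i : Fin (n * n), i.val ≠ 0 → i.val ≠ 1 → μ (chainPos n i) = 0 := by
  simp only [derivC_cubicTest_mem_iff, constantCoeff_polarDeriv_cubicG]
  constructor
  · intro h
    refine ⟨by simpa using h ⟨0, by omega⟩, fun i hi0 hi1 => ?_⟩
    simpa [hi0, hi1] using h i
  · rintro ⟨hk, hrest⟩ i
    split_ifs with h0 h1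
    · exact hk
    · rw [hk, mul_zero]
    · exact hrest i h0 h1

/-- `v` itself is a kernel field (`g = 1`). -/
theorem cubicDir_kernel (h2 : 2 ≤ n * n) (i : Fin (n * n)) :
    derivC (cubicDir h2) (cubicTest h2 i) ∈ graphIdeal n := by
  refine (cubic_kernelField_iff h2 (cubicDir h2)).2 ⟨?_, fun i hi0 hi1 => ?_⟩ i
  · rw [cubicDir_chainPos, cubicDir_chainPos]
    simp only [show (1 : ℕ) ≠ 0 from by norm_num, if_true, if_false, mul_neg, mul_one, add_neg_cancel]
  · rw [cubicDir_chainPos]; simp only [hi0, hi1, if_false]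

/-- `D_μ G₁` along a kernel field, under the masking substitution:
`ψ(D_μ G₁) = 3μ_{p₁}·s² + (α − 2s)·(μ_{p₀} + α μ_{p₁})`. -/
theorem maskHom_polarDeriv_cubicG_one (h2 : 2 ≤ n * n) (μ : Fin n × Fin n → MvPolynomial (MatMulVars n) ℂ) :
    maskHom (cubicDir h2) (cubicW n) (polarDeriv μ (cubicG h2 ⟨1, by omega⟩)) =
      Polynomial.X ^ 2 * (3 * Polynomial.C (μ (chainPos n ⟨1, by omega⟩))) +
        (Polynomial.C (cubicA h2) - 2 * Polynomial.X) *
          (Polynomial.C (μ (chainPos n ⟨0, by omega⟩)) +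
            Polynomial.C (cubicA h2) * Polynomial.C (μ (chainPos n ⟨1, by omega⟩))) := by
  classical
  simp only [cubicG, show (1 : ℕ) ≠ 0 from by norm_num, if_false, if_true, polarDeriv_add, polarDeriv_X, sq,
    polarDeriv_mul, polarDeriv_C, polarDeriv_ofNat, zero_mul, zero_add, map_add, map_mul, map_zero,
    maskHom_cubic_C, maskHom_cubic_X, maskHom_cubic_two, cubicDir_chainPos, cubicW, pow_one, map_neg, map_one]
  ring

/-- **ONE ROUND STAYS BLIND BELOW ORDER `2`**: along every kernel field `μ`, `s²` divides the masked
image of every test AND of every derivative `D_μ tᵢ` (`D_μ t₀ = 0`, `D_μ t₁ ↦ 3μ_{p₁} s²`, `D_μ t_i = 0`). -/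
theorem X_pow_two_dvd_maskHom_derivC_cubicTest (h2 : 2 ≤ n * n)
    {μ : Fin n × Fin n → MvPolynomial (MatMulVars n) ℂ} (hker : ∀ i, derivC μ (cubicTest h2 i) ∈ graphIdeal n)
    (i : Fin (n * n)) :
    Polynomial.X ^ 2 ∣ maskHom (cubicDir h2) (cubicW n) (liftF n (derivC μ (cubicTest h2 i))) := by
  classical
  obtain ⟨hk, hrest⟩ := (cubic_kernelField_iff h2 μ).1 hker
  have hkC : Polynomial.C (μ (chainPos n ⟨0, by omega⟩)) +
      Polynomial.C (cubicA h2) * Polynomial.C (μ (chainPos n ⟨1, by omega⟩)) =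
        (0 : Polynomial (MvPolynomial (MatMulVars n) ℂ)) := by
    rw [← Polynomial.C_mul, ← Polynomial.C_add, hk, Polynomial.C_0]
  rw [← substF_cubicG, ← substF_polarDeriv, liftF_substF]
  by_cases h0 : i.val = 0
  · rw [show i = ⟨0, by omega⟩ from Fin.ext h0]
    simp only [cubicG, if_true, polarDeriv_add, polarDeriv_X, polarDeriv_mul, polarDeriv_C, zero_mul, zero_add,
      map_add, map_mul, maskHom_cubic_C, hkC]
    exact dvd_zero _
  by_cases h1 : i.val = 1
  · rw [show i = ⟨1, by omega⟩ from Fin.ext h1, maskHom_polarDeriv_cubicG_one, hkC, mul_zero, add_zero]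
    exact dvd_mul_right _ _
  · simp only [cubicG, h0, h1, if_false, polarDeriv_X, maskHom_cubic_C, hrest i h0 h1, Polynomial.C_0]
    exact dvd_zero _

/-! ## The negative half: no kernel field reaches order one in one round -/

/-- **ONE ROUND CANNOT REACH ORDER ONE.**  For EVERY kernel field `μ` of a realisation `E` of the cubic
specimen (`hto`/`hfrom`: its tests are exactly the `tᵢ`) there is a system containing the `μ`-deflation of `E` (the exact realisation of
`T(E) ∪ D_μ T(E)`) whose test ideal is initially isolated to order `1` over NO base pair. -/
theorem cubic_one_round_not_order_one (h2 : 2 ≤ n * n) {E : EqSystem n}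
    (hto : ∀ j ∈ E.tests, ∃ i, E.testPoly j = cubicTest h2 i)
    (hfrom : ∀ i, ∃ j ∈ E.tests, E.testPoly j = cubicTest h2 i)
    (μ : Fin n × Fin n → MvPolynomial (MatMulVars n) ℂ)
    (hker : ∀ j ∈ E.tests, derivC μ (E.testPoly j) ∈ graphIdeal n) :
    ∃ E' : EqSystem n, E'.circuit.IsFanInTwo ∧ E.DeflatesTo μ E' ∧ ∀ y, ¬ E'.IdealInitIsolatedAt 1 y := by
  classical
  have hker' : ∀ i, derivC μ (cubicTest h2 i) ∈ graphIdeal n := fun i => by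
    obtain ⟨j, hj, hji⟩ := hfrom i
    rw [← hji]; exact hker j hj
  obtain ⟨E', hfan, hto', hfrom'⟩ :=
    exists_realisation_list (E.tests.map E.testPoly ++ E.tests.map fun j => derivC μ (E.testPoly j))
  refine ⟨E', hfan, ⟨fun j hj => hfrom' _ (List.mem_append_left _ (List.mem_map.2 ⟨j, hj, rfl⟩)),
    fun j hj => hfrom' _ (List.mem_append_right _ (List.mem_map.2 ⟨j, hj, rfl⟩))⟩, fun y => ?_⟩
  refine not_idealInitIsolatedAt_of_maskCert (lam := cubicDir h2) (w := cubicW n) (K := 1) (N := 2)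
    (by norm_num) (fun _ => le_rfl) (fun o => ?_)
    ⟨chainPos n ⟨1, by omega⟩, rfl, by rw [cubicDir_chainPos]; simp⟩
  rcases List.mem_append.1 (hto' _ (List.get_mem _ o)) with hm | hm
  · obtain ⟨j, hj, he⟩ := List.mem_map.1 hm
    obtain ⟨i, hi⟩ := hto j hj
    rw [← he, hi]
    exact (pow_dvd_pow Polynomial.X (by norm_num : 2 ≤ 3)).trans (X_pow_three_dvd_maskHom_cubicTest h2 i)
  · obtain ⟨j, hj, he⟩ := List.mem_map.1 hm
    obtain ⟨i, hi⟩ := hto j hj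
    rw [← he, hi]
    exact X_pow_two_dvd_maskHom_derivC_cubicTest h2 hker' i

/-- **THE CUBIC SPECIMEN.**  For `n² ≥ 2`: a CORRECT degree-`4` system, ideal-initially-isolated to
NO order `K ≤ 2` over any base pair, such that for EVERY kernel field `μ` some system containing its
`μ`-deflation is initially isolated to order `1` over no base pair. -/
theorem exists_cubicSystem (h2 : 2 ≤ n * n) : ∃ E : EqSystem n, E.Correct ∧ E.IsDegLe 4 ∧
    (∀ j ∈ E.tests, ∃ i, E.testPoly j = cubicTest h2 i) ∧ (∀ i, ∃ j ∈ E.tests, E.testPoly j = cubicTest h2 i) ∧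
    (∀ K, K < 3 → ∀ y, ¬ E.IdealInitIsolatedAt K y) ∧
    ∀ μ : Fin n × Fin n → MvPolynomial (MatMulVars n) ℂ,
      (∀ j ∈ E.tests, derivC μ (E.testPoly j) ∈ graphIdeal n) →
        ∃ E' : EqSystem n, E.DeflatesTo μ E' ∧ ∀ y, ¬ E'.IdealInitIsolatedAt 1 y := by
  classical
  obtain ⟨E, hfan, hto, hfrom⟩ := exists_realisation_list ((List.finRange (n * n)).map (cubicTest h2))
  have hto' : ∀ j ∈ E.tests, ∃ i, E.testPoly j = cubicTest h2 i := fun j hj => by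
    obtain ⟨i, -, hi⟩ := List.mem_map.1 (hto j hj)
    exact ⟨i, hi.symm⟩
  have hfrom' : ∀ i, ∃ j ∈ E.tests, E.testPoly j = cubicTest h2 i := fun i =>
    hfrom _ (List.mem_map_of_mem (List.mem_finRange i))
  refine ⟨E, ⟨hfan, Set.ext fun x => ⟨fun hx => ?_, fun hx j hj => ?_⟩⟩, fun o => ?_, hto', hfrom', fun K hK y => ?_,
    fun μ hμ => ?_⟩
  · refine (cubicTest_zero_iff h2 x).1 fun i => ?_
    obtain ⟨j, hj, hji⟩ := hfrom' i
    rw [← hji]; exact hx j hj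
  · obtain ⟨i, hi⟩ := hto' j hj
    rw [hi]; exact (cubicTest_zero_iff h2 x).2 hx i
  · obtain ⟨i, hi⟩ := hto' _ (List.get_mem _ o)
    rw [hi]; exact totalDegree_cubicTest_le h2 i
  · refine not_idealInitIsolatedAt_of_maskCert (lam := cubicDir h2) (w := cubicW n) hK (fun _ => le_rfl)
      (fun o => ?_) ⟨chainPos n ⟨1, by omega⟩, rfl, by rw [cubicDir_chainPos]; simp⟩
    obtain ⟨i, hi⟩ := hto' (E.tests.get o) (List.get_mem _ _)
    rw [hi]; exact X_pow_three_dvd_maskHom_cubicTest h2 i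
  · obtain ⟨E', -, hD, hnot⟩ := cubic_one_round_not_order_one h2 hto' hfrom' μ hμ
    exact ⟨E', hD, hnot⟩

/-- **`¬ KernelFieldClauseDeg 4 1`: at degree `4`, ONE round of kernel-field deflation cannot be asked
to reach order `1`** — the cubic specimen over `n = 2` (cost-free: every kernel field fails). -/
theorem not_kernelFieldClauseDeg_four_one : ¬ KernelFieldClauseDeg 4 1 := by
  rintro ⟨c, h⟩
  obtain ⟨E, hE, hdeg, -, -, -, hneg⟩ := exists_cubicSystem (n := 2) (by norm_num)
  obtain ⟨μ, Eμ, -, -, hker, -, hiso⟩ := h 2 (by norm_num) E hE hdeg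
  obtain ⟨E', hD, hnot⟩ := hneg μ hker
  obtain ⟨y, hy⟩ := hiso E' hD
  exact hnot y hy

/-- Hence `KernelFieldClauseDeg 4 K` fails for every `K ≤ 1`. -/
theorem not_kernelFieldClauseDeg_four_le_one {K : ℕ} (hK : K ≤ 1) : ¬ KernelFieldClauseDeg 4 K :=
  fun h => not_kernelFieldClauseDeg_four_one (h.mono_order hK)

end Summit.MatrixMultiplication.MatrixMultiplication.Theorems.GraphEquations

end
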